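import Literature.NumberTheory.GaloisCohomology.Howard2004.CoeffTowerKolyvaginSystems
import Literature.NumberTheory.GaloisCohomology.Howard2004.FiniteSingularNatural
import HarnessLib

/-!
# Howard 2004, Rem. 1.2.4: morphisms of tower settings over a ring map (the functoriality of `KS`)

Topic `NumberTheory/GaloisCohomology/Howard2004` (sequel to `CoeffTowerKolyvaginSystems`; (T3-iii) of
cell `pub/bsd-print-x9`, lit g31 2026-08-28).  DEFINITIONS WITH BODIES and small proved lemmas; no
named fact, no instance, no `sorry`.

Howard, Rem. 1.2.4 [arXiv:1202.6340 Rem. 2.2.4, p. 7 L13–27]: «The module of Kolyvagin systems has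
the following functorial properties: (i) if `𝓛′ ⊂ 𝓛` then there is a map `KS(T,F,𝓛) → KS(T,F,𝓛′)`;
(ii) if `H¹_F(K_v,T) ⊂ H¹_{F′}(K_v,T)` at every place `v` then there is a map `KS(T,F,𝓛) → KS(T,F′,𝓛)`;
(iii) if `R → R′` is a ring homomorphism then there is a map
`KS(T,F,𝓛) ⊗_R R′ → KS(T ⊗_R R′, F ⊗_R R′, 𝓛)`, where the local condition `F ⊗_R R′` is defined as the
image of `H¹_F(K_v,T) ⊗_R R′ → H¹(K_v, T ⊗_R R′)` for `v ∈ Σ(F)`, and `Σ(F ⊗_R R′) = Σ(F)`.»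

This file types the SOURCE DATA of (i)+(ii)+(iii) at once, in the presentation style of the cell's
`IsQuotientBy` (target-agnostic: the target setting brings its own carrier types, e.g. the D1
lineage's Eisenstein specialisation `Λ → Λ/(q_m)`), as a **morphism of tower settings over a ring map
`φ : R → R′`**:

* `CoeffTowerSetting.Hom φ S S′` — level maps `f_k : T^{(k)} → T′^{(k)}` (additive, `φ`-semilinear,
  `Γ_K`-equivariant, compatible with the reductions), maps of the Kolyvagin quotients
  `fq_{k,n} : T^{(k)}/I_n → T′^{(k)}/I′_n` PINNED by `fq ∘ π_n = π′_n ∘ f` (they exist because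
  `φ(I_n(T)) ⊆ I_n(T′)`, `FrobIdealRingChangeProofs.map_levelIdeal_le`), equivariant and compatible
  with the reductions `rq`; the same complex embedding `jbar` (same ring class fields, hence the same
  transverse conditions); `𝓛′ ⊆ 𝓛` ((i)); the local conditions of the target CONTAIN the images of
  those of the source at every place ((ii)+(iii): `F ⊗ R′` = image, possibly enlarged — the D1
  coupling «`F_Λ ⊗ S_m ≤ F_q`»); and the finite–singular maps commute with the change (`fs_compat`,
  the naturality clause of `FiniteSingularNatural` across the two settings).
* `LevelData.mem_selmerAt_iff` — `H¹_{F(n)}(K, T/I_nT)` placewise (the companions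
  `SelmerTriple.atLevel_cond_inr_of_not_mem` / `cond_inr_eq_of_mem` are in `SelmerTriples`);
* the induced maps on cohomology `Hom.fH1`, `Hom.fH1Loc`, `Hom.fqH1`, `Hom.fqH1Loc`, with the
  commuting squares a push-forward of Kolyvagin systems consumes: localisation (`localization_fH1`,
  `localization_fqH1`), the presentations (`fqH1Loc_localCohomologyMap`), the reductions
  (`fqH1_rqH1`), and «unramified ↦ unramified», «transverse ↦ transverse»
  (`fH1Loc_mem_unramified`, `fH1Loc_mem_transverseCondition`).

LEVEL INDEXING (x9-p1 LEAD ruling 2026-08-28 16:08Z, (q2)(a)): a `Hom` is level-PARALLEL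
(`f_k : T^{(k)} → T′^{(k)}`); when the target's level `k` is a quotient of the source's level `σ(k)`
for a growing `σ` (the Eisenstein specialisation `Λ → Λ/(q_m)`: `(q_m, p^{k+1}) ⊇ 𝔪_Λ^{(m+1)(k+1)}`
only), one first passes to the SUB-TOWER `S.reindex σ` (separate constructor, file
`TowerReindex.lean`) and then gives a `Hom φ (S.reindex σ) S′`.  PRINT ANCHOR of the whole chain:
Howard Thm. 2.2.10, proof, first sentence [arXiv Thm. 3.2.10, p. 17 L78–81] «At every height-one
prime `𝔭 ≠ pΛ`, Remark 1.2.4 and Lemma 2.2.7 (local comparison) yield a map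
`KS(𝐓, F_Λ, 𝓛_s(𝐓)) → KS(T_𝔭, F_𝔭, 𝓛_s(T_𝔭))`»; Lemma 2.2.7 [p. 16 L142–148] is the print source
of `cond_le` (`H¹_{F_Λ}(K_v, 𝐓/𝔭𝐓) → H¹_{F_𝔭}(K_v, T_𝔭)`).

NOT here (x9-p1 LEAD lineage, by the cell's division of labour): the push-forward
`Hom.pushforward : S.KolyvaginSystem → S′.KolyvaginSystem` itself and the transport of `LargePrimes`
(`𝓛_s(T) ⊆ 𝓛_s(T′)`: `FrobIdealRingChangeProofs.kolyvaginPrimes_subset_kolyvaginPrimes_ringChange_of_free`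
levelwise).  Optional later: the canonical target `S.restrictCoeff I` (levels `modIdeal`,
`LevelData.canonical`) with its `Hom (Ideal.Quotient.mk I) S (S.restrictCoeff I)`.
BSD is not proved by any of this.
[cite: Howard2004HeegnerKolyvagin, Rem. 1.2.4 (arXiv Rem. 2.2.4, p. 7, L13–27)]
-/

set_option autoImplicit false

noncomputable section

open Function NumberField IsDedekindDomain Field CategoryTheory
open scoped NumberField ContRepresentation Classical TensorProduct

namespace Literature.NumberTheory.GaloisCohomology.Howard2004

open Literature.NumberTheory.GaloisRepresentations
open Literature.NumberTheory.GaloisRepresentations.DiscreteGaloisModule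

/-! ## A commuting-square lemma for `H¹` of equivariant additive maps (cocycle level) -/

section Square

variable {F : Type} [Field F]
  {M₁ : Type} [AddCommGroup M₁] [TopologicalSpace M₁] [DiscreteTopology M₁]
  {M₂ : Type} [AddCommGroup M₂] [TopologicalSpace M₂] [DiscreteTopology M₂]
  {M₃ : Type} [AddCommGroup M₃] [TopologicalSpace M₃] [DiscreteTopology M₃]
  {M₄ : Type} [AddCommGroup M₄] [TopologicalSpace M₄] [DiscreteTopology M₄]

/-- `H¹` of an equivariant additive map on an explicit cocycle class: `[z] ↦ [π ∘ z]`.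
[cite: SerreGaloisCohomology1997, I §2.2] -/
theorem cohomologyMap_one_oneCocycleClass (τ₁ : DiscreteGaloisModule F M₁) (τ₂ : DiscreteGaloisModule F M₂)
    (π : M₁ →+ M₂) (hπ : ∀ (g : absoluteGaloisGroup F) (x : M₁), π (τ₁ g x) = τ₂ g (π x))
    (z : contOneCocycles τ₁.toTopRep) :
    ContinuousRep.cohomologyMap τ₁ τ₂ π continuous_of_discreteTopology hπ 1 (oneCocycleClass _ z) =
      oneCocycleClass τ₂.toTopRep
        (contOneCocycles.pullback (ContinuousMonoidHom.id (absoluteGaloisGroup F))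
          (X := τ₁.toTopRep) (Y := τ₂.toTopRep)
          (TopRep.ofHom ⟨⟨π.toIntLinearMap, continuous_of_discreteTopology⟩,
            fun g => ContinuousLinearMap.ext fun x => hπ g x⟩) z) :=
  map_oneCocycleClass _ _ _ z

/-- **Commuting square on `H¹`**: if `b ∘ a = d ∘ c` pointwise (equivariant additive maps of discrete
`Γ_F`-modules), then `H¹(b) ∘ H¹(a) = H¹(d) ∘ H¹(c)`. [cite: SerreGaloisCohomology1997, I §2.2] -/
theorem cohomologyMap_one_comm_sq (τ₁ : DiscreteGaloisModule F M₁) (τ₂ : DiscreteGaloisModule F M₂)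
    (τ₃ : DiscreteGaloisModule F M₃) (τ₄ : DiscreteGaloisModule F M₄)
    (a : M₁ →+ M₂) (ha : ∀ (g : absoluteGaloisGroup F) (x : M₁), a (τ₁ g x) = τ₂ g (a x))
    (b : M₂ →+ M₄) (hb : ∀ (g : absoluteGaloisGroup F) (x : M₂), b (τ₂ g x) = τ₄ g (b x))
    (c : M₁ →+ M₃) (hc : ∀ (g : absoluteGaloisGroup F) (x : M₁), c (τ₁ g x) = τ₃ g (c x))
    (d : M₃ →+ M₄) (hd : ∀ (g : absoluteGaloisGroup F) (x : M₃), d (τ₃ g x) = τ₄ g (d x))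
    (h : ∀ x, b (a x) = d (c x)) (x : galoisCohomology τ₁ 1) :
    ContinuousRep.cohomologyMap τ₂ τ₄ b continuous_of_discreteTopology hb 1
        (ContinuousRep.cohomologyMap τ₁ τ₂ a continuous_of_discreteTopology ha 1 x) =
      ContinuousRep.cohomologyMap τ₃ τ₄ d continuous_of_discreteTopology hd 1
        (ContinuousRep.cohomologyMap τ₁ τ₃ c continuous_of_discreteTopology hc 1 x) := by
  obtain ⟨z, rfl⟩ := oneCocycleClass_surjective τ₁.toTopRep x
  rw [cohomologyMap_one_oneCocycleClass, cohomologyMap_one_oneCocycleClass,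
    cohomologyMap_one_oneCocycleClass, cohomologyMap_one_oneCocycleClass]
  congr 1
  refine Subtype.ext (ContinuousMap.ext fun g => ?_)
  exact h _

end Square

/-! ## Unfolding `LevelData.selmerAt` placewise (for the push-forward) -/

section SelmerAt

variable {K : Type} [Field K] [NumberField K] {M : Type} [AddCommGroup M] [TopologicalSpace M]
  [DiscreteTopology M] {R : Type} [CommRing R] [Module R M]
  {p : ℕ} [Fact p.Prime] {ρ : DiscreteGaloisModule K M} {t : SelmerTriple p ρ}
  {N : Finset (HeightOneSpectrum (𝓞 K)) → Type} [∀ n, AddCommGroup (N n)]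
  [∀ n, TopologicalSpace (N n)] [∀ n, DiscreteTopology (N n)] [∀ n, Module R (N n)]

/-- **`c ∈ H¹_{F(n)}(K, T/I_nT)` placewise**: at every place `v`, `loc_v c` lies in the image under
`H¹(K_v, π_n)` of the condition of `F(n)` at `v` (Def. 1.2.3 with Def. 1.1.3's propagation).
[cite: Howard2004HeegnerKolyvagin, Def. 1.2.3 and Def. 1.1.3 (arXiv p. 7 L1–6, p. 5 L93–99)] -/
theorem LevelData.mem_selmerAt_iff (D : LevelData R ρ t N) (jbar : AlgebraicClosure K →+* ℂ)
    (n : Finset (HeightOneSpectrum (𝓞 K))) (c : galoisCohomology (D.ρq n) 1) :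
    c ∈ D.selmerAt jbar n ↔ ∀ v : Place K,
      galoisCohomology.localization (D.ρq n) v 1 c ∈
        ((t.atLevel jbar n).cond v).map ((D.isQuotientBy n).localCohomologyMap v 1) := by
  rw [LevelData.selmerAt, SelmerStructure.mem_selmerGroup_iff]
  rfl

end SelmerAt

/-! ## Morphisms of tower settings over a ring map -/

section Hom

variable {p : ℕ} [Fact p.Prime] {K : Type} [Field K] [NumberField K]
  {R : Type} [CommRing R] [IsLocalRing R] [Algebra ℤ_[p] R]
  {N : ℕ → Type} [∀ k, AddCommGroup (N k)] [∀ k, TopologicalSpace (N k)]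
  [∀ k, DiscreteTopology (N k)] [∀ k, Module R (N k)]
  {Rk : ℕ → Type} [∀ k, CommRing (Rk k)] [∀ k, IsLocalRing (Rk k)] [∀ k, TopologicalSpace (Rk k)]
  [∀ k, DiscreteTopology (Rk k)] [∀ k, Algebra ℤ_[p] (Rk k)] [∀ k, Algebra R (Rk k)]
  [∀ k, Module (Rk k) (N k)] [∀ k, IsScalarTower R (Rk k) (N k)]
  {Nbar : Type} [AddCommGroup Nbar] [TopologicalSpace Nbar] [DiscreteTopology Nbar]
  [∀ k, Module (Rk k) Nbar]
  {Nq : ℕ → Finset (HeightOneSpectrum (𝓞 K)) → Type} [∀ k n, AddCommGroup (Nq k n)]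
  [∀ k n, TopologicalSpace (Nq k n)] [∀ k n, DiscreteTopology (Nq k n)]
  [∀ k n, Module (Rk k) (Nq k n)] [∀ k n, Module R (Nq k n)]
  [∀ k n, IsScalarTower R (Rk k) (Nq k n)]
  {R' : Type} [CommRing R'] [IsLocalRing R'] [Algebra ℤ_[p] R']
  {N' : ℕ → Type} [∀ k, AddCommGroup (N' k)] [∀ k, TopologicalSpace (N' k)]
  [∀ k, DiscreteTopology (N' k)] [∀ k, Module R' (N' k)]
  {Rk' : ℕ → Type} [∀ k, CommRing (Rk' k)] [∀ k, IsLocalRing (Rk' k)] [∀ k, TopologicalSpace (Rk' k)]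
  [∀ k, DiscreteTopology (Rk' k)] [∀ k, Algebra ℤ_[p] (Rk' k)] [∀ k, Algebra R' (Rk' k)]
  [∀ k, Module (Rk' k) (N' k)] [∀ k, IsScalarTower R' (Rk' k) (N' k)]
  {Nbar' : Type} [AddCommGroup Nbar'] [TopologicalSpace Nbar'] [DiscreteTopology Nbar']
  [∀ k, Module (Rk' k) Nbar']
  {Nq' : ℕ → Finset (HeightOneSpectrum (𝓞 K)) → Type} [∀ k n, AddCommGroup (Nq' k n)]
  [∀ k n, TopologicalSpace (Nq' k n)] [∀ k n, DiscreteTopology (Nq' k n)]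
  [∀ k n, Module (Rk' k) (Nq' k n)] [∀ k n, Module R' (Nq' k n)]
  [∀ k n, IsScalarTower R' (Rk' k) (Nq' k n)]

/-- **A morphism of tower settings over the ring map `φ : R → R′`** (the source data of Rem. 1.2.4
(i)+(ii)+(iii) along which `KS` is functorial): level maps `f_k : T^{(k)} → T′^{(k)}` that are
additive, `φ`-semilinear, `Γ_K`-equivariant and compatible with the reductions; maps of the Kolyvagin
quotients `fq_{k,n} : T^{(k)}/I_n → T′^{(k)}/I′_n` pinned by `fq ∘ π_n = π′_n ∘ f`, equivariant and
compatible with `rq`; the same `jbar`; `𝓛′ ⊆ 𝓛`; the target conditions contain the images of the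
source conditions at every place («`F ⊗_R R′` is defined as the image …», then `F ≤ F′`); and the
finite–singular maps commute with the change (on the finite classes).
[cite: Howard2004HeegnerKolyvagin, Rem. 1.2.4 (arXiv Rem. 2.2.4, p. 7, L13–27)] -/
structure CoeffTowerSetting.Hom (φ : R →+* R') (S : CoeffTowerSetting p K R N Rk Nbar Nq)
    (S' : CoeffTowerSetting p K R' N' Rk' Nbar' Nq') where
  /-- the level maps `T^{(k)} → T′^{(k)}` -/
  f : ∀ k, N k →+ N' k
  f_smul : ∀ k (r : R) (x : N k), f k (r • x) = φ r • f k x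
  f_equivariant : ∀ k (σ : absoluteGaloisGroup K) (x : N k), f k (S.T.ρ k σ x) = S'.T.ρ k σ (f k x)
  f_red : ∀ k (x : N (k + 1)), f k (S.T.red k x) = S'.T.red k (f (k + 1) x)
  /-- the maps of the Kolyvagin quotients `T^{(k)}/I_n → T′^{(k)}/I′_n` -/
  fq : ∀ k n, Nq k n →+ Nq' k n
  fq_comp : ∀ k n (x : N k), fq k n ((S.LD k).π n x) = (S'.LD k).π n (f k x)
  fq_equivariant : ∀ k n (σ : absoluteGaloisGroup K) (y : Nq k n),
    fq k n ((S.LD k).ρq n σ y) = (S'.LD k).ρq n σ (fq k n y)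
  fq_rq : ∀ k n (y : Nq (k + 1) n), fq k n (S.rq k n y) = S'.rq k n (fq (k + 1) n y)
  /-- same ring class fields (hence the same transverse conditions) -/
  jbar_eq : S'.jbar = S.jbar
  /-- (i) `𝓛′ ⊆ 𝓛` -/
  primes_subset : S'.L ⊆ S.L
  /-- (ii)+(iii) the target conditions contain the images of the source conditions, every place -/
  cond_le : ∀ k (v : Place K), ((S.t k).cond v).map
      (ContinuousRep.cohomologyMap ((S.T.ρ k).toLocal v) ((S'.T.ρ k).toLocal v) (f k)
        continuous_of_discreteTopology (fun _ x => f_equivariant k _ x) 1) ≤ (S'.t k).cond v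
  /-- the finite–singular maps commute with the change, on the finite (unramified) classes -/
  fs_compat : ∀ k n (v : HeightOneSpectrum (𝓞 K)),
    ∀ c ∈ unramifiedSubgroup (GaloisRep.toLocal v ((S.LD k).ρq n)) 1,
      (S'.LD k).fs n v (localH1Map ((S.LD k).ρq n) ((S'.LD k).ρq n) v (fq k n)
          (fun _ y => fq_equivariant k n _ y) c) =
        TensorProduct.map (singularQuotientMap ((S.LD k).ρq n) ((S'.LD k).ρq n) v (fq k n)
            (fun _ y => fq_equivariant k n _ y)).toIntLinearMap LinearMap.id ((S.LD k).fs n v c)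

namespace CoeffTowerSetting.Hom

variable {φ : R →+* R'} {S : CoeffTowerSetting p K R N Rk Nbar Nq}
  {S' : CoeffTowerSetting p K R' N' Rk' Nbar' Nq'}

/-- `H¹(K, f_k) : H¹(K, T^{(k)}) → H¹(K, T′^{(k)})`. [cite: Howard2004HeegnerKolyvagin, Rem. 1.2.4 (iii) (arXiv p. 7, L19–27)] -/
def fH1 (h : Hom φ S S') (k : ℕ) : galoisCohomology (S.T.ρ k) 1 →+ galoisCohomology (S'.T.ρ k) 1 :=
  ContinuousRep.cohomologyMap (S.T.ρ k) (S'.T.ρ k) (h.f k) continuous_of_discreteTopology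
    (h.f_equivariant k) 1

/-- `H¹(K_v, f_k)` at a place `v`. [cite: Howard2004HeegnerKolyvagin, Rem. 1.2.4 (iii) (arXiv p. 7, L19–27)] -/
def fH1Loc (h : Hom φ S S') (k : ℕ) (v : Place K) :
    galoisCohomology ((S.T.ρ k).toLocal v) 1 →+ galoisCohomology ((S'.T.ρ k).toLocal v) 1 :=
  ContinuousRep.cohomologyMap ((S.T.ρ k).toLocal v) ((S'.T.ρ k).toLocal v) (h.f k)
    continuous_of_discreteTopology (fun _ x => h.f_equivariant k _ x) 1

/-- `H¹(K, fq_{k,n}) : H¹(K, T^{(k)}/I_n) → H¹(K, T′^{(k)}/I′_n)`. [cite: Howard2004HeegnerKolyvagin, Rem. 1.2.4 (iii) (arXiv p. 7, L19–27)] -/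
def fqH1 (h : Hom φ S S') (k : ℕ) (n : Finset (HeightOneSpectrum (𝓞 K))) :
    galoisCohomology ((S.LD k).ρq n) 1 →+ galoisCohomology ((S'.LD k).ρq n) 1 :=
  ContinuousRep.cohomologyMap ((S.LD k).ρq n) ((S'.LD k).ρq n) (h.fq k n)
    continuous_of_discreteTopology (h.fq_equivariant k n) 1

/-- `H¹(K_v, fq_{k,n})` at a place `v`. [cite: Howard2004HeegnerKolyvagin, Rem. 1.2.4 (iii) (arXiv p. 7, L19–27)] -/
def fqH1Loc (h : Hom φ S S') (k : ℕ) (n : Finset (HeightOneSpectrum (𝓞 K))) (v : Place K) :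
    galoisCohomology (((S.LD k).ρq n).toLocal v) 1 →+ galoisCohomology (((S'.LD k).ρq n).toLocal v) 1 :=
  ContinuousRep.cohomologyMap (((S.LD k).ρq n).toLocal v) (((S'.LD k).ρq n).toLocal v) (h.fq k n)
    continuous_of_discreteTopology (fun _ y => h.fq_equivariant k n _ y) 1

/-- At a finite place `fqH1Loc` is the `localH1Map` of `FiniteSingularNatural` (definitionally).
[cite: Howard2004HeegnerKolyvagin, Rem. 1.2.4 (iii) (arXiv p. 7, L19–27)] -/
theorem fqH1Loc_inr (h : Hom φ S S') (k : ℕ) (n : Finset (HeightOneSpectrum (𝓞 K)))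
    (v : HeightOneSpectrum (𝓞 K)) :
    h.fqH1Loc k n (Sum.inr v) =
      localH1Map ((S.LD k).ρq n) ((S'.LD k).ρq n) v (h.fq k n) (fun _ y => h.fq_equivariant k n _ y) :=
  rfl

/-- **Localisation commutes with `H¹(f)`**: `loc_v ∘ H¹(K, f_k) = H¹(K_v, f_k) ∘ loc_v`.
[cite: SerreGaloisCohomology1997, I §2.4 (restriction is natural in the module)] -/
theorem localization_fH1 (h : Hom φ S S') (k : ℕ) (v : Place K) (x : galoisCohomology (S.T.ρ k) 1) :
    galoisCohomology.localization (S'.T.ρ k) v 1 (h.fH1 k x) =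
      h.fH1Loc k v (galoisCohomology.localization (S.T.ρ k) v 1 x) := by
  obtain ⟨z, rfl⟩ := oneCocycleClass_surjective (S.T.ρ k).toTopRep x
  have e1 : h.fH1 k (oneCocycleClass _ z) = oneCocycleClass _ _ := map_oneCocycleClass _ _ _ z
  have e2 : galoisCohomology.localization (S.T.ρ k) v 1 (oneCocycleClass _ z) = oneCocycleClass _ _ :=
    map_oneCocycleClass _ _ _ z
  rw [e1, e2]
  refine (map_oneCocycleClass _ _ _ _).trans ?_
  symm
  refine (map_oneCocycleClass _ _ _ _).trans ?_
  congr 1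

/-- Localisation commutes with `H¹(fq)`. [cite: SerreGaloisCohomology1997, I §2.4] -/
theorem localization_fqH1 (h : Hom φ S S') (k : ℕ) (n : Finset (HeightOneSpectrum (𝓞 K)))
    (v : Place K) (x : galoisCohomology ((S.LD k).ρq n) 1) :
    galoisCohomology.localization ((S'.LD k).ρq n) v 1 (h.fqH1 k n x) =
      h.fqH1Loc k n v (galoisCohomology.localization ((S.LD k).ρq n) v 1 x) := by
  obtain ⟨z, rfl⟩ := oneCocycleClass_surjective ((S.LD k).ρq n).toTopRep x
  have e1 : h.fqH1 k n (oneCocycleClass _ z) = oneCocycleClass _ _ := map_oneCocycleClass _ _ _ z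
  have e2 : galoisCohomology.localization ((S.LD k).ρq n) v 1 (oneCocycleClass _ z) =
      oneCocycleClass _ _ := map_oneCocycleClass _ _ _ z
  rw [e1, e2]
  refine (map_oneCocycleClass _ _ _ _).trans ?_
  symm
  refine (map_oneCocycleClass _ _ _ _).trans ?_
  congr 1

/-- **The presentations commute with the change, on local `H¹`**:
`H¹(K_v, fq) ∘ H¹(K_v, π_n) = H¹(K_v, π′_n) ∘ H¹(K_v, f)` (from `fq ∘ π_n = π′_n ∘ f`).
[cite: Howard2004HeegnerKolyvagin, Rem. 1.2.4 (iii) (arXiv p. 7, L19–27)] -/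
theorem fqH1Loc_localCohomologyMap (h : Hom φ S S') (k : ℕ) (n : Finset (HeightOneSpectrum (𝓞 K)))
    (v : Place K) (c : galoisCohomology ((S.T.ρ k).toLocal v) 1) :
    h.fqH1Loc k n v (((S.LD k).isQuotientBy n).localCohomologyMap v 1 c) =
      ((S'.LD k).isQuotientBy n).localCohomologyMap v 1 (h.fH1Loc k v c) :=
  cohomologyMap_one_comm_sq _ _ _ _ _ _ _ _ _ _ _ _ (fun x => h.fq_comp k n x) c

/-- The same globally: `H¹(K, fq) ∘ H¹(K, π_n) = H¹(K, π′_n) ∘ H¹(K, f)`.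
[cite: Howard2004HeegnerKolyvagin, Rem. 1.2.4 (iii) (arXiv p. 7, L19–27)] -/
theorem fqH1_cohomologyMap (h : Hom φ S S') (k : ℕ) (n : Finset (HeightOneSpectrum (𝓞 K)))
    (c : galoisCohomology (S.T.ρ k) 1) :
    h.fqH1 k n (((S.LD k).isQuotientBy n).cohomologyMap 1 c) =
      ((S'.LD k).isQuotientBy n).cohomologyMap 1 (h.fH1 k c) :=
  cohomologyMap_one_comm_sq _ _ _ _ _ _ _ _ _ _ _ _ (fun x => h.fq_comp k n x) c

/-- **The reductions commute with the change**: `H¹(fq_k) ∘ H¹(rq_k) = H¹(rq′_k) ∘ H¹(fq_{k+1})`.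
[cite: Howard2004HeegnerKolyvagin, Def. 1.2.3 / §1.6 (arXiv p. 7 L1–12, p. 11 L49–50)] -/
theorem fqH1_rqH1 (h : Hom φ S S') (k : ℕ) (n : Finset (HeightOneSpectrum (𝓞 K)))
    (c : galoisCohomology ((S.LD (k + 1)).ρq n) 1) :
    h.fqH1 k n (S.rqH1 k n c) = S'.rqH1 k n (h.fqH1 (k + 1) n c) :=
  cohomologyMap_one_comm_sq _ _ _ _ _ _ _ _ _ _ _ _ (fun y => h.fq_rq k n y) c

/-- `H¹(f_k) ∘ H¹(red_k) = H¹(red′_k) ∘ H¹(f_{k+1})` (so `H¹(f)` maps `lim` to `lim`).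
[cite: Howard2004HeegnerKolyvagin, §1.6 (arXiv p. 12, L29–33)] -/
theorem fH1_redH1 (h : Hom φ S S') (k : ℕ) (c : galoisCohomology (S.T.ρ (k + 1)) 1) :
    h.fH1 k (S.T.redH1 k c) = S'.T.redH1 k (h.fH1 (k + 1) c) :=
  cohomologyMap_one_comm_sq _ _ _ _ _ _ _ _ _ _ _ _ (fun x => h.f_red k x) c

/-- **`H¹(f)` carries `lim_k H¹(K, T^{(k)})` into `lim_k H¹(K, T′^{(k)})`.**
[cite: Howard2004HeegnerKolyvagin, §1.6 (arXiv p. 12, L29–33)] -/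
theorem mapsTo_limitH1 (h : Hom φ S S') {x : ∀ k, galoisCohomology (S.T.ρ k) 1}
    (hx : x ∈ S.T.limitH1) : (fun k => h.fH1 k (x k)) ∈ S'.T.limitH1 := by
  intro k
  change S'.T.redH1 k (h.fH1 (k + 1) (x (k + 1))) = h.fH1 k (x k)
  rw [← fH1_redH1, hx k]

/-- **Unramified classes go to unramified classes** under `H¹(K_v, fq)` (tree `map_unramifiedSubgroup_le`).
[cite: Howard2004HeegnerKolyvagin, Def. 1.1.1 (arXiv p. 5, L49–51)] -/
theorem fqH1Loc_mem_unramifiedSubgroup (h : Hom φ S S') (k : ℕ) (n : Finset (HeightOneSpectrum (𝓞 K)))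
    (v : HeightOneSpectrum (𝓞 K)) {c : galoisCohomology (GaloisRep.toLocal v ((S.LD k).ρq n)) 1}
    (hc : c ∈ unramifiedSubgroup (GaloisRep.toLocal v ((S.LD k).ρq n)) 1) :
    h.fqH1Loc k n (Sum.inr v) c ∈ unramifiedSubgroup (GaloisRep.toLocal v ((S'.LD k).ρq n)) 1 :=
  localH1Map_mem_unramifiedSubgroup _ _ v (h.fq k n) (fun _ y => h.fq_equivariant k n _ y) hc

/-- Unramified classes go to unramified classes under `H¹(K_v, f)`.
[cite: Howard2004HeegnerKolyvagin, Def. 1.1.1 (arXiv p. 5, L49–51)] -/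
theorem fH1Loc_mem_unramifiedSubgroup (h : Hom φ S S') (k : ℕ) (v : HeightOneSpectrum (𝓞 K))
    {c : galoisCohomology (GaloisRep.toLocal v (S.T.ρ k)) 1}
    (hc : c ∈ unramifiedSubgroup (GaloisRep.toLocal v (S.T.ρ k)) 1) :
    h.fH1Loc k (Sum.inr v) c ∈ unramifiedSubgroup (GaloisRep.toLocal v (S'.T.ρ k)) 1 :=
  localH1Map_mem_unramifiedSubgroup _ _ v (h.f k) (fun _ x => h.f_equivariant k _ x) hc

/-- **Transverse classes go to transverse classes**: Howard's `H¹_tr(K_ℓ, ·) = ker (res to Γ_L)` is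
functorial in the module (`L` depends only on `ℓ` and `jbar`).
[cite: Howard2004HeegnerKolyvagin, §1.1 transverse condition and §1.2 (arXiv p. 5 L52–56, p. 6 L84–95)] -/
theorem fqH1Loc_mem_transverseCondition (h : Hom φ S S') (k : ℕ) (n : Finset (HeightOneSpectrum (𝓞 K)))
    (ℓ : ℕ) (jbar : AlgebraicClosure K →+* ℂ) (v : HeightOneSpectrum (𝓞 K))
    {c : galoisCohomology (GaloisRep.toLocal v ((S.LD k).ρq n)) 1}
    (hc : c ∈ transverseCondition p ((S.LD k).ρq n) ℓ jbar v) :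
    h.fqH1Loc k n (Sum.inr v) c ∈ transverseCondition p ((S'.LD k).ρq n) ℓ jbar v := by
  obtain ⟨z, rfl⟩ := oneCocycleClass_surjective _ c
  have hc' : resSubgroup (DiscreteGaloisModule.toTopRep (GaloisRep.toLocal v ((S.LD k).ρq n)))
      (transverseFixer p ℓ jbar v) 1 (oneCocycleClass _ z) = 0 := hc
  have hc'' := (map_oneCocycleClass _ _ _ _).symm.trans hc'
  rw [oneCocycleClass_eq_zero_iff] at hc''
  obtain ⟨y, hy⟩ := hc''
  change resSubgroup (DiscreteGaloisModule.toTopRep (GaloisRep.toLocal v ((S'.LD k).ρq n)))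
      (transverseFixer p ℓ jbar v) 1 (h.fqH1Loc k n (Sum.inr v) (oneCocycleClass _ z)) = 0
  have e1 : h.fqH1Loc k n (Sum.inr v) (oneCocycleClass _ z) = oneCocycleClass _ _ :=
    map_oneCocycleClass _ _ _ z
  rw [e1]
  refine (map_oneCocycleClass _ _ _ _).trans ?_
  rw [oneCocycleClass_eq_zero_iff]
  refine ⟨h.fq k n y, fun σ => ?_⟩
  have hσ := hy σ
  change h.fq k n (z.1 _) = _
  change z.1 _ = _ at hσ
  rw [hσ, map_sub]
  exact congrArg (· - h.fq k n y) (h.fq_equivariant k n _ y)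

end CoeffTowerSetting.Hom

end Hom

end Literature.NumberTheory.GaloisCohomology.Howard2004

end
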